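import Literature.AnabelianGeometry.AbsoluteAnabelian.GaloisCyclotomeH2Levels
import Literature.NumberTheory.GaloisRepresentations.RootsOfUnityInverseLimit
import Literature.NumberTheory.GaloisRepresentations.PadicCoefficientsTowerTorsion
import HarnessLib

/-!
# The `p`-adic local invariant map: `inv_∞ : H²(G_K, ℤ_p(1)) ⥲ ℤ_p` as the limit of the residue maps
# `inv_{p^k} : H²(G_K, μ_{p^k}) ⥲ ℤ/p^k` (Kato, LNM 1553, Ch. II Thm. 1.4.1 (1); Serre, *Local Fields* XIII §3)

Topic `NumberTheory/GaloisCohomology`; namespace `Literature.NumberTheory.GaloisCohomology`.  Definitions with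
bodies and theorems only (no named fact, no instance, no `sorry`).

For a field `K` and a prime `p`, the `p`-power roots of unity `μ_{p^k}(K̄)` (the tree's discrete Galois modules
`DiscreteGaloisModule.mu K (p ^ k)`) form an inverse system over `ℕ` with the `p`-th power maps
`μ_{p^{k+1}} ↠ μ_{p^k}` as transitions (`muPadicSystem K p`, an instance of the tree's `DiscreteInvSystem`, NSW
(2.7.5)); its limit representation `tateModuleMuPadic K p = lim_k μ_{p^k}(K̄)` is the `p`-adic Tate module
**`ℤ_p(1)(K̄) = T_p μ`** with its profinite topology and jointly continuous `Γ_K`-action (the `p`-part of the tree's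
`tateModuleMu K = Ẑ(1)`, `RootsOfUnityInverseLimit.lean`).  We prove:

* `continuousCohomologyOnePadicTateModuleEquiv` — `H¹_cont(G_K, ℤ_p(1)) ≃+ lim_k H¹(G_K, μ_{p^k})` (`char K = 0`);
* `continuousCohomologyTwoPadicTateModuleEquiv` — `H²_cont(G_K, ℤ_p(1)) ≃+ lim_k H²(G_K, μ_{p^k})` for a
  non-archimedean local field `K` of characteristic `0` (NSW II §7 Thm. 2.7.5 / Cor. 2.7.6: the `H¹(G_K, μ_{p^k})`
  are finite);
* `cohomologyLimitMuPadicToPadicInt`, `…_bijective` — **`lim_k H²(G_K, μ_{p^k}) ≃+ ℤ_p`** through THE residue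
  maps `inv_{p^k} = Prop121vii.invLevel K (p^k)` of local class field theory (`LocalResidueMapQmodZ.lean`; bijective
  and compatible with the power maps, `invLevel_muPowHom` of `GaloisCyclotomeH2Levels.lean`) and `PadicInt.lift`;
* ★ `invPadic K p : H²_cont(G_K, ℤ_p(1)) →+ ℤ_p` — **the `p`-adic invariant map**, `invPadic_bijective`,
  `invPadicEquiv : H²_cont(G_K, ℤ_p(1)) ≃+ ℤ_p`, with its LEVEL FORMULA
  `toZModPow_invPadic : (inv_∞ y mod p^k) = inv_{p^k}(H²(ℤ_p(1) ↠ μ_{p^k}) y)` and the uniqueness statement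
  `eq_invPadic_of_toZModPow` (an additive map with that level formula IS `inv_∞`).

This is Kato's "canonical isomorphism `H²(K, ℚ_ℓ(1)) ≅ ℚ_ℓ`" (LNM 1553 II Thm. 1.4.1 (1)) at `ℓ = p` on the
integral level `H²(K, ℤ_p(1)) ≅ ℤ_p` (Serre, *Local Fields* XIII §3 Prop. 7: `inv_K : H²(K, K̄ˣ) ≅ ℚ/ℤ`, read on
`p`-power torsion and passed to the limit; NSW (7.1.8) (ii), (7.2.6)).  Floor K3-c of the K3 programme of the line
`kato_lever` on crux K★ `stmt-BirchSwinnertonDyer-22226` (memo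
`Summits/BirchSwinnertonDyer/BirchSwinnertonDyer/Cruxes/StarredOptimalManinUnitFiveSeven/Lines/kato-lever-K3-programme.md` §2);
BSD / K★ are not proved by any of this.

## References
* K. Kato, *Lectures on the approach to Iwasawa theory for Hasse–Weil L-functions via B_dR, Part I*, LNM 1553
  (1993), Ch. II Thm. 1.4.1 (1) and 1.4.2. [Kato1993LNM1553]
* J.-P. Serre, *Local Fields*, GTM 67 (1979), Ch. XIII §3 (Prop. 6–7), Ch. XIV §1. [SerreLocalFields1979]
* J. Neukirch, A. Schmidt, K. Wingberg, *Cohomology of Number Fields*, 2nd ed. (2008), II §7 Thm. 2.7.5,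
  Cor. 2.7.6; VII (7.1.8), (7.2.6). [NeukirchSchmidtWingberg2008]
-/

noncomputable section

open CategoryTheory Function
open Field IsNonarchimedeanLocalField ValuativeRel

universe u

namespace Literature.NumberTheory.GaloisCohomology

open _root_.TopRep _root_.ContRepresentation _root_.ContinuousCohomology
open Literature.NumberTheory.GaloisRepresentations
open Literature.NumberTheory.GaloisRepresentations.DiscreteGaloisModule
open Literature.AnabelianGeometry.AbsoluteAnabelian

/-! ### The inverse system `(μ_{p^k}(K̄))_k` and its limit `ℤ_p(1)` -/

section System

variable (K : Type u) [Field K] (p : ℕ)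

/-- Exponent bookkeeping: `p^n · p^{m-n} = p^m` for `n ≤ m`. [folklore] -/
private theorem pow_mul_pow_sub {n m : ℕ} (h : n ≤ m) : p ^ n * p ^ (m - n) = p ^ m := by
  rw [← pow_add, Nat.add_sub_cancel' h]

/-- **The inverse system `(μ_{p^k}(K̄))_{k ∈ ℕ}`** of discrete `Γ_K`-modules, ordered by `≤` on the
exponents, with the power maps `μ_{p^m} ↠ μ_{p^n}`, `ζ ↦ ζ^{p^{m-n}}` (the tree's `muPow`) as transition maps
(`abbrev`, so that `(muPadicSystem K p).ρ k` unfolds to `mu K (p ^ k)` reducibly): the system whose limit is the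
`p`-adic Tate module `ℤ_p(1) = T_p μ`. [cite: NeukirchSchmidtWingberg2008, II §7 Thm 2.7.5] -/
abbrev muPadicSystem : DiscreteInvSystem (absoluteGaloisGroup K) (fun k : ℕ => MuCarrier K (p ^ k)) where
  le n m := n ≤ m
  le_refl n := le_refl n
  le_trans h₁ h₂ := h₁.trans h₂
  ρ k := mu K (p ^ k)
  red {n m} h := muPow K (p ^ m) (p ^ n) (p ^ (m - n)) (pow_mul_pow_sub p h)
  red_smul h g x := muVal_injective K _ (by
    rw [muVal_muPow, muVal_apply, muVal_apply, muVal_muPow, smul_pow'])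
  red_refl n x := muVal_injective K _ (by
    rw [muVal_muPow, Nat.sub_self, pow_zero, pow_one])
  red_trans {a b c} h₁ h₂ x := muVal_injective K _ (by
    rw [muVal_muPow, muVal_muPow, muVal_muPow, ← pow_mul, ← pow_add]
    congr 2
    omega)

/-- The order relation of `muPadicSystem` is `≤` on exponents. [cite: NeukirchSchmidtWingberg2008, II §7 Thm 2.7.5] -/
@[simp] theorem muPadicSystem_le (n m : ℕ) : (muPadicSystem K p).le n m ↔ n ≤ m := Iff.rfl

/-- The modules of `muPadicSystem` are the `μ_{p^k}`. [cite: NeukirchSchmidtWingberg2008, II §7 Thm 2.7.5] -/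
@[simp] theorem muPadicSystem_ρ (k : ℕ) : (muPadicSystem K p).ρ k = mu K (p ^ k) := rfl

/-- The transition maps of `muPadicSystem` are the power maps `muPow`. [cite: NeukirchSchmidtWingberg2008, II §7 Thm 2.7.5] -/
theorem muPadicSystem_red {n m : ℕ} (h : n ≤ m) (v : MuCarrier K (p ^ m)) :
    (muPadicSystem K p).red h v = muPow K (p ^ m) (p ^ n) (p ^ (m - n)) (pow_mul_pow_sub p h) v := rfl

/-- The transition MORPHISMS of `muPadicSystem` (in Mathlib's `TopRep ℤ Γ_K`) are the tree's `muPowHom`.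
[cite: NeukirchSchmidtWingberg2008, II §7 Thm 2.7.5] -/
theorem muPadicSystem_redHom {n m : ℕ} (h : n ≤ m) :
    (muPadicSystem K p).redHom h = muPowHom K (p ^ m) (p ^ n) (p ^ (m - n)) (pow_mul_pow_sub p h) := rfl

variable [Fact p.Prime]

/-- **The transition maps `μ_{p^m} ↠ μ_{p^n}` are surjective** (`K̄` is algebraically closed).
[cite: NeukirchSchmidtWingberg2008, II §7 Thm 2.7.5] -/
theorem muPadicSystem_red_surjective {n m : ℕ} (h : n ≤ m) :
    Surjective ((muPadicSystem K p).red h) :=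
  muPow_surjective K (pow_mul_pow_sub p h) (pow_pos (Fact.out : p.Prime).pos _)

/-- The identity chain `k ↦ k` is cofinal in `ℕ`. [cite: NeukirchSchmidtWingberg2008, II §7 Thm 2.7.5] -/
def muPadicChain : (muPadicSystem K p).CofinalChain where
  seq i := i
  le_succ i := Nat.le_succ i
  cofinal n := ⟨n, le_refl n⟩

/-- **`ℤ_p(1)(K̄) := lim_k μ_{p^k}(K̄)`**, the `p`-adic Tate module of the roots of unity, as a jointly
continuous representation of `Γ_K` (profinite topology). [cite: NeukirchSchmidtWingberg2008, II §7 Thm 2.7.5] -/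
abbrev tateModuleMuPadic : ContinuousRep (absoluteGaloisGroup K) ℤ (muPadicSystem K p).limit :=
  (muPadicSystem K p).limitRep

end System

/-! ### `H¹(G_K, ℤ_p(1)) ≅ lim_k H¹(G_K, μ_{p^k})` for every field of characteristic `0` -/

section CharZero

variable (K : Type u) [Field K] [CharZero K] (p : ℕ) [Fact p.Prime]

/-- **`H¹_cont(G_K, ℤ_p(1)) ≃ lim_k H¹(G_K, μ_{p^k})`** for a field `K` of characteristic `0` (NSW II §7
Thm. 2.7.5 in degree `1`: the `μ_{p^k}(K̄)` are finite), with coordinates the maps induced by the projections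
`ℤ_p(1) → μ_{p^k}`. [cite: NeukirchSchmidtWingberg2008, II §7 Thm 2.7.5] -/
def continuousCohomologyOnePadicTateModuleEquiv :
    continuousCohomology 1 (tateModuleMuPadic K p).toTopRep ≃+ (muPadicSystem K p).cohomologyLimit 1 :=
  (muPadicSystem K p).continuousCohomologyOneLimitEquiv (muPadicChain K p)
    (fun h => muPadicSystem_red_surjective K p h) fun k =>
      haveI : NeZero (p ^ k) := ⟨pow_ne_zero _ (Fact.out : p.Prime).ne_zero⟩
      Prop121vii.finite_muCarrier K (p ^ k)

end CharZero

/-! ### `p`-adic local fields: `H²(G_K, ℤ_p(1)) ≅ lim_k H²(G_K, μ_{p^k})` -/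

section Local

variable (K : Type u) [Field K] [ValuativeRel K] [TopologicalSpace K] [IsNonarchimedeanLocalField K]
  [CharZero K] (p : ℕ) [Fact p.Prime]

/-- `Z¹(G_K, μ_{p^k})` is finite for a non-archimedean local field `K` of characteristic `0`.
[cite: SerreGaloisCohomology1997, II §5.2 Prop. 14] -/
theorem finite_contOneCocycles_mu_pow (k : ℕ) : Finite (contOneCocycles (mu K (p ^ k)).toTopRep) :=
  finite_contOneCocycles_mu K ⟨p ^ k, pow_pos (Fact.out : p.Prime).pos k⟩

/-- **`H²_cont(G_K, ℤ_p(1)) ≃ lim_k H²(G_K, μ_{p^k})`** for a non-archimedean local field `K` of characteristic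
`0` (NSW II §7 Thm. 2.7.5 / Cor. 2.7.6: the `H¹(G_K, μ_{p^k})` are finite), with coordinates the maps induced by
the projections `ℤ_p(1) ↠ μ_{p^k}`. [cite: NeukirchSchmidtWingberg2008, II §7 Thm 2.7.5] -/
def continuousCohomologyTwoPadicTateModuleEquiv :
    continuousCohomology 2 (tateModuleMuPadic K p).toTopRep ≃+ (muPadicSystem K p).cohomologyLimit 2 :=
  haveI : CompactSpace (absoluteGaloisGroup K) := absoluteGaloisGroup_compactSpace K
  (muPadicSystem K p).continuousCohomologyTwoLimitEquiv (muPadicChain K p)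
    (fun h => muPadicSystem_red_surjective K p h) (finite_contOneCocycles_mu_pow K p)

/-- Coordinates of the comparison isomorphism in degree `2`. [cite: NeukirchSchmidtWingberg2008, II §7 Thm 2.7.5] -/
@[simp] theorem coe_continuousCohomologyTwoPadicTateModuleEquiv_apply
    (y : continuousCohomology 2 (tateModuleMuPadic K p).toTopRep) (k : ℕ) :
    (continuousCohomologyTwoPadicTateModuleEquiv K p y :
        ∀ k, continuousCohomology 2 ((muPadicSystem K p).ρ k).toTopRep) k =
      cohomologyMap ((muPadicSystem K p).projHom k) 2 y := rfl

/-! ### The residue maps are compatible along the tower: `lim_k H²(G_K, μ_{p^k}) ≅ ℤ_p` -/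

/-- **`inv_{p^n}(H²(μ_{p^m} ↠ μ_{p^n}) y) = inv_{p^m}(y) mod p^n`** for `n ≤ m`: THE residue maps
`Prop121vii.invLevel` commute with the transition maps of `muPadicSystem` (`invLevel_muPowHom`).
[cite: SerreLocalFields1979, Ch. XIII §3 Prop. 7] -/
theorem invLevel_cohomologyMap_redHom {n m : ℕ} (h : n ≤ m) (y : galoisCohomology (mu K (p ^ m)) 2) :
    haveI : NeZero (p ^ n) := ⟨pow_ne_zero _ (Fact.out : p.Prime).ne_zero⟩
    haveI : NeZero (p ^ m) := ⟨pow_ne_zero _ (Fact.out : p.Prime).ne_zero⟩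
    Prop121vii.invLevel K (p ^ n) (cohomologyMap ((muPadicSystem K p).redHom h) 2 y) =
      ZMod.castHom (pow_dvd_pow p h) (ZMod (p ^ n)) (Prop121vii.invLevel K (p ^ m) y) := by
  haveI : NeZero (p ^ n) := ⟨pow_ne_zero _ (Fact.out : p.Prime).ne_zero⟩
  haveI : NeZero (p ^ m) := ⟨pow_ne_zero _ (Fact.out : p.Prime).ne_zero⟩
  rw [muPadicSystem_redHom]
  exact invLevel_muPowHom K (pow_mul_pow_sub p h) y

/-- The family of residues `(inv_{p^k}(x_k))_k` of a compatible family of classes `x ∈ lim_k H²(G_K, μ_{p^k})`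
is a compatible sequence in `∏_k ℤ/p^k` (the tree's `compatSeq p`). [cite: SerreLocalFields1979, Ch. XIII §3 Prop. 7] -/
def invFamily : (muPadicSystem K p).cohomologyLimit 2 →+ compatSeq p where
  toFun x := ⟨fun k =>
      haveI : NeZero (p ^ k) := ⟨pow_ne_zero _ (Fact.out : p.Prime).ne_zero⟩
      Prop121vii.invLevel K (p ^ k) ((x : ∀ k, continuousCohomology 2 ((muPadicSystem K p).ρ k).toTopRep) k),
    fun k => by
      have hx := x.2 (Nat.le_succ k)
      dsimp only
      rw [← invLevel_cohomologyMap_redHom K p (Nat.le_succ k), hx]⟩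
  map_zero' := Subtype.ext (funext fun k => by
    haveI : NeZero (p ^ k) := ⟨pow_ne_zero _ (Fact.out : p.Prime).ne_zero⟩
    change Prop121vii.invLevel K (p ^ k) 0 = 0
    exact map_zero _)
  map_add' x y := Subtype.ext (funext fun k => by
    haveI : NeZero (p ^ k) := ⟨pow_ne_zero _ (Fact.out : p.Prime).ne_zero⟩
    change Prop121vii.invLevel K (p ^ k) (_ + _) = Prop121vii.invLevel K (p ^ k) _ + Prop121vii.invLevel K (p ^ k) _
    exact map_add _ _ _)

/-- Levels of `invFamily`. [cite: SerreLocalFields1979, Ch. XIII §3 Prop. 7] -/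
@[simp] theorem invFamily_coe_apply (x : (muPadicSystem K p).cohomologyLimit 2) (k : ℕ) :
    (invFamily K p x).1 k =
      (haveI : NeZero (p ^ k) := ⟨pow_ne_zero _ (Fact.out : p.Prime).ne_zero⟩
       Prop121vii.invLevel K (p ^ k) ((x : ∀ k, continuousCohomology 2 ((muPadicSystem K p).ρ k).toTopRep) k)) :=
  rfl

/-- **`lim_k H²(G_K, μ_{p^k}) → ℤ_p`**, `x ↦` the `p`-adic integer with residues `inv_{p^k}(x_k)` (`PadicInt.lift`);
additive. [cite: SerreLocalFields1979, Ch. XIII §3 Prop. 7] -/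
def cohomologyLimitMuPadicToPadicInt : (muPadicSystem K p).cohomologyLimit 2 →+ ℤ_[p] :=
  (PadicInt.lift (compatSeqEval_compat p)).toAddMonoidHom.comp (invFamily K p)

/-- Residues of the comparison map: `(… x) mod p^k = inv_{p^k}(x_k)`. [cite: SerreLocalFields1979, Ch. XIII §3 Prop. 7] -/
theorem toZModPow_cohomologyLimitMuPadicToPadicInt (x : (muPadicSystem K p).cohomologyLimit 2) (k : ℕ) :
    PadicInt.toZModPow k (cohomologyLimitMuPadicToPadicInt K p x) =
      (haveI : NeZero (p ^ k) := ⟨pow_ne_zero _ (Fact.out : p.Prime).ne_zero⟩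
       Prop121vii.invLevel K (p ^ k) ((x : ∀ k, continuousCohomology 2 ((muPadicSystem K p).ρ k).toTopRep) k)) := by
  change ((PadicInt.toZModPow k).comp (PadicInt.lift (compatSeqEval_compat p))) (invFamily K p x) = _
  rw [PadicInt.lift_spec]
  rfl

/-- **`lim_k H²(G_K, μ_{p^k}) ≃ ℤ_p`** (injective: the residues determine a `p`-adic integer and each `inv_{p^k}`
is injective; surjective: the residues of `z ∈ ℤ_p` pulled back along the bijections `inv_{p^k}` form a compatible
family by `invLevel_cohomologyMap_redHom`). [cite: SerreLocalFields1979, Ch. XIII §3 Prop. 7] -/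
theorem cohomologyLimitMuPadicToPadicInt_bijective : Bijective (cohomologyLimitMuPadicToPadicInt K p) := by
  constructor
  · intro x y hxy
    refine Subtype.ext (funext fun k => ?_)
    haveI : NeZero (p ^ k) := ⟨pow_ne_zero _ (Fact.out : p.Prime).ne_zero⟩
    apply (invLevel_bijective K (p ^ k)).1
    have h := congrArg (PadicInt.toZModPow k) hxy
    rwa [toZModPow_cohomologyLimitMuPadicToPadicInt, toZModPow_cohomologyLimitMuPadicToPadicInt] at h
  · intro z
    have pre : ∀ k : ℕ, ∃ xk : continuousCohomology 2 ((muPadicSystem K p).ρ k).toTopRep,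
        (haveI : NeZero (p ^ k) := ⟨pow_ne_zero _ (Fact.out : p.Prime).ne_zero⟩
         Prop121vii.invLevel K (p ^ k) xk) = PadicInt.toZModPow k z := fun k => by
      haveI : NeZero (p ^ k) := ⟨pow_ne_zero _ (Fact.out : p.Prime).ne_zero⟩
      exact (invLevel_bijective K (p ^ k)).2 _
    choose x hx using pre
    have hxmem : x ∈ (muPadicSystem K p).cohomologyLimit 2 := by
      intro n m h
      haveI : NeZero (p ^ n) := ⟨pow_ne_zero _ (Fact.out : p.Prime).ne_zero⟩
      haveI : NeZero (p ^ m) := ⟨pow_ne_zero _ (Fact.out : p.Prime).ne_zero⟩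
      apply (invLevel_bijective K (p ^ n)).1
      change Prop121vii.invLevel K (p ^ n) (cohomologyMap ((muPadicSystem K p).redHom h) 2 (x m)) =
        Prop121vii.invLevel K (p ^ n) (x n)
      rw [invLevel_cohomologyMap_redHom K p h, hx m, hx n, ← RingHom.comp_apply,
        PadicInt.zmod_cast_comp_toZModPow n m h]
    refine ⟨⟨x, hxmem⟩, PadicInt.ext_of_toZModPow.mp fun k => ?_⟩
    rw [toZModPow_cohomologyLimitMuPadicToPadicInt]
    exact hx k

/-- **`lim_k H²(G_K, μ_{p^k}) ≃+ ℤ_p`** (additively). [cite: SerreLocalFields1979, Ch. XIII §3 Prop. 7] -/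
def cohomologyLimitMuPadicEquivPadicInt : (muPadicSystem K p).cohomologyLimit 2 ≃+ ℤ_[p] :=
  AddEquiv.ofBijective _ (cohomologyLimitMuPadicToPadicInt_bijective K p)

/-! ### The `p`-adic invariant map `inv_∞ : H²(G_K, ℤ_p(1)) ⥲ ℤ_p` -/

/-- ★ **The `p`-adic local invariant map `inv_∞ : H²_cont(G_K, ℤ_p(1)) → ℤ_p`** of a non-archimedean local field
`K` of characteristic `0`: the composite `H²(G_K, lim_k μ_{p^k}) ⥲ lim_k H²(G_K, μ_{p^k}) ⥲ ℤ_p` of NSW (2.7.5)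
with the limit of THE residue maps `inv_{p^k}` (Kato II Thm. 1.4.1 (1) at `ℓ = p`, integral level).
[cite: Kato1993LNM1553, Ch. II Thm. 1.4.1 (1)] [cite: SerreLocalFields1979, Ch. XIII §3 Prop. 7] -/
def invPadic : continuousCohomology 2 (tateModuleMuPadic K p).toTopRep →+ ℤ_[p] :=
  (cohomologyLimitMuPadicToPadicInt K p).comp
    (continuousCohomologyTwoPadicTateModuleEquiv K p).toAddMonoidHom

/-- ★ **LEVEL FORMULA**: `inv_∞(y) mod p^k = inv_{p^k}(H²(ℤ_p(1) ↠ μ_{p^k}) y)` — the `p`-adic invariant map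
reduces, at every level, to THE residue map of local class field theory on the image of `y` under the projection
`ℤ_p(1) ↠ μ_{p^k}`. [cite: Kato1993LNM1553, Ch. II Thm. 1.4.1 (1)] [cite: SerreLocalFields1979, Ch. XIII §3 Prop. 7] -/
theorem toZModPow_invPadic (y : continuousCohomology 2 (tateModuleMuPadic K p).toTopRep) (k : ℕ) :
    PadicInt.toZModPow k (invPadic K p y) =
      (haveI : NeZero (p ^ k) := ⟨pow_ne_zero _ (Fact.out : p.Prime).ne_zero⟩
       Prop121vii.invLevel K (p ^ k) (cohomologyMap ((muPadicSystem K p).projHom k) 2 y)) :=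
  toZModPow_cohomologyLimitMuPadicToPadicInt K p _ k

/-- ★ **`inv_∞ : H²_cont(G_K, ℤ_p(1)) → ℤ_p` is bijective** (Kato II Thm. 1.4.1 (1), integral level;
Serre XIII §3 / NSW (7.1.8)). [cite: Kato1993LNM1553, Ch. II Thm. 1.4.1 (1)] [cite: SerreLocalFields1979, Ch. XIII §3 Prop. 7] -/
theorem invPadic_bijective : Bijective (invPadic K p) :=
  (cohomologyLimitMuPadicToPadicInt_bijective K p).comp (continuousCohomologyTwoPadicTateModuleEquiv K p).bijective

/-- ★ **`H²_cont(G_K, ℤ_p(1)) ≃+ ℤ_p`** — the `p`-adic invariant map as an additive isomorphism.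
[cite: Kato1993LNM1553, Ch. II Thm. 1.4.1 (1)] [cite: SerreLocalFields1979, Ch. XIII §3 Prop. 7] -/
def invPadicEquiv : continuousCohomology 2 (tateModuleMuPadic K p).toTopRep ≃+ ℤ_[p] :=
  AddEquiv.ofBijective _ (invPadic_bijective K p)

/-- `invPadicEquiv` is `invPadic` on elements. [cite: Kato1993LNM1553, Ch. II Thm. 1.4.1 (1)] -/
@[simp] theorem invPadicEquiv_apply (y : continuousCohomology 2 (tateModuleMuPadic K p).toTopRep) :
    invPadicEquiv K p y = invPadic K p y := rfl

/-- **Uniqueness / characterisation by the levels**: a map `f : H²_cont(G_K, ℤ_p(1)) → ℤ_p` whose residue mod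
`p^k` is `inv_{p^k} ∘ H²(ℤ_p(1) ↠ μ_{p^k})` for every `k` IS `inv_∞` (a `p`-adic integer is determined by its
residues). [cite: Kato1993LNM1553, Ch. II Thm. 1.4.1 (1) and 1.4.2] -/
theorem eq_invPadic_of_toZModPow (f : continuousCohomology 2 (tateModuleMuPadic K p).toTopRep → ℤ_[p])
    (hf : ∀ (k : ℕ) (y : continuousCohomology 2 (tateModuleMuPadic K p).toTopRep),
      PadicInt.toZModPow k (f y) =
        (haveI : NeZero (p ^ k) := ⟨pow_ne_zero _ (Fact.out : p.Prime).ne_zero⟩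
         Prop121vii.invLevel K (p ^ k) (cohomologyMap ((muPadicSystem K p).projHom k) 2 y))) :
    f = invPadic K p :=
  funext fun y => PadicInt.ext_of_toZModPow.mp fun k => by rw [hf, toZModPow_invPadic]

/-- **`H²_cont(G_K, ℤ_p(1))` is torsion-free** (it is `≅ ℤ_p`): `m • y = 0` with `m ≠ 0` forces `y = 0`.
[cite: NeukirchSchmidtWingberg2008, VII (7.1.8)] -/
theorem eq_zero_of_nsmul_eq_zero {m : ℕ} (hm : m ≠ 0)
    {y : continuousCohomology 2 (tateModuleMuPadic K p).toTopRep} (hy : m • y = 0) : y = 0 := by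
  apply (invPadic_bijective K p).1
  rw [map_zero]
  have h : (m : ℤ_[p]) * invPadic K p y = 0 := by
    rw [← nsmul_eq_mul, ← map_nsmul, hy, map_zero]
  exact (mul_eq_zero.mp h).resolve_left (Nat.cast_ne_zero.mpr hm)

end Local

end Literature.NumberTheory.GaloisCohomology

end
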